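import Summits.CriticalPhenomena.PercolationContinuityZ3.Theorems.PercNearOneGluingNoHeavyLowerTailSahiCombMixAtomsFive

/-!
# The comb hierarchy for Sahi's `E_k`, LXIV: member moments and their `W_0`-defects are comb-positive off `e` (multipliers of the
# single-member order-4 certificates at `n = 5`)

Support file of the one-cut programme (crux `NoHeavyLowerTail`, stmt-CriticalPhenomena-4575; cell `prim-masterthm`, seat P3, gen 11;
`run/shared/lean/prim/prim-masterthm/prim-masterthm-p3/HIERARCHY.md` §19).  The `q = 1` certificates of the three canonical single-member cells
(`SahiCombMix.CombFiveSingleCell 1/2/3`, `…SahiCombMixFiveSingleCells`) found by this seat's LP (kit j130039/j130045) use only TWO kinds of multipliers besides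
constants: member moments `μ_p(W_S) = μ_p(⋂_{i∈S} W_i)` and their `W_0`-defects `μ_p(W_S ∖ W_0) = μ_p(W_S) − μ_p(W_{S∪{0}})` (the coin is OR-ed into `W_0`).  Both are
`μ_p`-expectations of nonnegative functions ignoring `e`, hence comb-positive at multidegree `1` off `e`:
* `ind_biInter5_insert` — members of the ∩-closed family of events ignoring `e` ignore `e` (pointwise);
* `combPos_mom5_off` — `p ↦ μ_p(W_S)` is comb-positive at multidegree `1` off `e`;
* `combPos_momDiff5_off` — `p ↦ μ_p(W_S) − μ_p(W_{{0}∪S})` is comb-positive at multidegree `1` off `e`.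
HONEST FRAMING: bookkeeping; nothing here asserts (M⁺-k) or `C_k` for `k ≥ 3`. [this work]
-/

noncomputable section

open scoped Classical

namespace Summit.CriticalPhenomena.PercolationContinuityZ3.Theorems

open Finset Function
open Literature.Combinatorics.Sahi2008
open Literature.Probability.Percolation.BHK2006 (ind_le_one ind_inter)
open Literature.Probability.Percolation.DecisionTree (ind ind_of_mem ind_of_not_mem ind_nonneg)
open SahiComb

variable {ι : Type} [Fintype ι]

namespace SahiCombMix

section Moments

variable (W : Fin 5 → Set (Set ι)) (e : ι) (hWe : ∀ (j : Fin 5) (b : Bool), secAt e b (W j) = W j)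
include hWe

omit [Fintype ι] in
/-- Indicators of members of the ∩-closed family of five events ignoring `e` ignore `e`. [folklore] -/
theorem ind_biInter5_insert (S : Finset (Fin 5)) (ω : Set ι) :
    ind (⋂ i ∈ S, W i) (insert e ω) = ind (⋂ i ∈ S, W i) ω := by
  rw [← secAt_biInter W e hWe S true]
  exact ind_secAt_insert e true _ ω

/-- **Member moments are comb-positive at multidegree `1` off `e`**: `p ↦ μ_p(⋂_{i∈S} W_i)`. [this work] -/
theorem combPos_mom5_off (S : Finset (Fin 5)) :
    CombPos (update (fun _ : ι => 1) e 0) (fun p => ex (bernoulliWeight p) (ind (⋂ i ∈ S, W i))) :=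
  (combPos_ex_ind (⋂ i ∈ S, W i)).of_ignores e fun p s =>
    SahiCombDisjunct.ex_update_of_ignores' e (fun ω => ind_biInter5_insert W e hWe S ω) p s

/-- **`W_0`-defects of member moments are comb-positive at multidegree `1` off `e`**: `p ↦ μ_p(W_S) − μ_p(W_{{0}∪S}) = μ_p(W_S ∖ W_0)`
(the expectation of `1_{W_S}·(1 − 1_{W_0}) ≥ 0`). [this work] -/
theorem combPos_momDiff5_off (S : Finset (Fin 5)) :
    CombPos (update (fun _ : ι => 1) e 0)
      (fun p => ex (bernoulliWeight p) (ind (⋂ i ∈ S, W i)) - ex (bernoulliWeight p) (ind (⋂ i ∈ insert (0 : Fin 5) S, W i))) := by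
  have hpt : ∀ ω, ind (⋂ i ∈ S, W i) ω * (1 - ind (W 0) ω)
      = ind (⋂ i ∈ S, W i) ω - ind (⋂ i ∈ insert (0 : Fin 5) S, W i) ω := fun ω => by
    rw [Finset.set_biInter_insert, ind_inter]; ring
  have h0 := (combPos_ex (ι := ι) (h := fun ω => ind (⋂ i ∈ S, W i) ω * (1 - ind (W 0) ω)) fun ω =>
      mul_nonneg (ind_nonneg _ ω) (sub_nonneg.2 (ind_le_one _ ω))).of_ignores e
    fun p s => SahiCombDisjunct.ex_update_of_ignores' e (fun ω => by
      show ind (⋂ i ∈ S, W i) (insert e ω) * (1 - ind (W 0) (insert e ω)) = ind (⋂ i ∈ S, W i) ω * (1 - ind (W 0) ω)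
      rw [ind_biInter5_insert W e hWe, ind_U5_insert W e hWe]) p s
  refine h0.congr fun p => ?_
  have ee := SahiMixture.ex_eq_lin (bernoulliWeight p) (fun ω => ind (⋂ i ∈ S, W i) ω * (1 - ind (W 0) ω)) ![1, -1]
    ![ind (⋂ i ∈ S, W i), ind (⋂ i ∈ insert (0 : Fin 5) S, W i)] (fun ω => by
      rw [hpt ω]
      simp only [Fin.sum_univ_succ, Fin.sum_univ_zero, Matrix.cons_val_zero, Matrix.cons_val_succ]
      ring)
  simp only [Fin.sum_univ_succ, Fin.sum_univ_zero, Matrix.cons_val_zero, Matrix.cons_val_succ] at ee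
  rw [ee]; ring

end Moments

end SahiCombMix

end Summit.CriticalPhenomena.PercolationContinuityZ3.Theorems

end
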